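import Mathlib

/-!
# `NoHeavyLowerTail` (crux stmt-CriticalPhenomena-4575), abstract sunflower cubic: THE CHAIN GAME IS BALANCED
# (an explicit core point for the interval-avoidance cost game of two independent walkers on a chain)

Support file (seat `prim-ineq-prove-1` gen 44; `--supports stmt-CriticalPhenomena-4575`).  No `sorry`, no named facts, no
measure theory: this file is the finite real-number inequality; `…SunflowerChainCover` applies it to chain-graph /
staircase-CNF cores.  Memo: run/shared/lean/prim/prim-ineq-prove-1/FINDING-CHAINCOVER-prove1-g44.md §1.

THE CHAIN GAME.  Points `k : Fin n` on a chain, a walker `X` with nonnegative weights `x i` on the positions `i : Fin (n+1)`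
(position `i` sits just below point `i`; position `n` is above every point), and a nonnegative MONOTONE function
`F : WithTop (Fin n) → ℝ` (think `F k = P(Y < k)` for a second, independent walker `Y`, `F ⊤ = 1`).  For a set of points `R`,
`next R i` is the first point of `R` at or above position `i` (`⊤` if none) and
    `G R = ∑ i, x i * F (next R i)`
(= `P(R ⊆ {k < X} ∪ {k > Y})`: the points of `R` below the walker `X` are free, the others must lie above `Y`).  `G` is antitone,
`G univ` plays the role of `μ(core)` and the prefixes `pre j = {k < j}` give `A_j := G (pre (j+1))`.
* `G_sdiff_ineq` (REMOVAL LEMMA): if `S` contains every point below `q`, then `G S · G (pre (q+1)) ≤ G (insert q S) · G (pre q)`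
  — removing `q` from a set containing the whole prefix below `q` inflates `G` by at most the factor `G (pre q) / G (pre (q+1))`.
  Proof: only the position `q` sees the difference (`G S − G (insert q S) = x q (F r − F q)`, `r` = next point of `S` above `q`;
  `G (pre q) − G (pre (q+1)) = x q (F ⊤ − F q)`), and TERMWISE `(F r − F q) F(next (pre (q+1)) i) ≤ (F ⊤ − F q) F(next S' i)`.
* **`G_mul_prod_le`** (THEOREM 1 of the memo, product form): for every `R`,
    `G R · ∏_{k ∉ R} G (pre (k+1)) ≤ G univ · ∏_{k ∉ R} G (pre k)`,
  by inserting the missing points from the bottom up (base case `R = univ` is an equality).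
* `prod_G_pre_succ_mul` (telescoping `∏_k G(pre (k+1)) · G ∅ = ∏_k G(pre k) · G univ`) and the CORE-POINT form
  **`G_le_prod_weights`**: with `τ k := G (pre (k+1)) / G (pre k) ∈ (0,1]`, `G R ≤ G ∅ · ∏_{k ∈ R} τ k` and `∏_k τ k = G univ / G ∅`
  — i.e. `−log τ` (the marginal vector of the increasing order) lies in the core of the cost game `−log G`; for `G ∅ = 1` these
  are exactly the balanced weights of `…SunflowerBalancedWeights` / the cover certificate of `…SunflowerChainCover`.
Nothing here uses product measures: the theorem holds for arbitrary independent walkers (memo §1, Remark (ii)); "prefix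
submodularity" is false (memo Remark (i)), the bottom-up insertion order is essential.
-/

namespace Summit.CriticalPhenomena.PercolationContinuityZ3.Theorems.SunflowerPartition

namespace ChainGame

open Finset

variable {n : ℕ}

/-! ## The game -/

/-- The first point of `R` at or above the position `i` (`⊤` if there is none). [this work] -/
def next (R : Finset (Fin n)) (i : Fin (n + 1)) : WithTop (Fin n) :=
  (R.filter fun k : Fin n => (i : ℕ) ≤ (k : ℕ)).min

/-- The chain game `G R = ∑ i, x i * F (next R i)`. [this work] -/
def G (x : Fin (n + 1) → ℝ) (F : WithTop (Fin n) → ℝ) (R : Finset (Fin n)) : ℝ :=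
  ∑ i : Fin (n + 1), x i * F (next R i)

/-- The prefix `{k : k < j}` of the chain. [this work] -/
def pre (j : ℕ) : Finset (Fin n) := univ.filter fun k : Fin n => (k : ℕ) < j

variable (x : Fin (n + 1) → ℝ) (F : WithTop (Fin n) → ℝ)

/-! ## Elementary facts about `next` and `pre` -/

/-- Enlarging the set can only lower the next point. [this work] -/
theorem next_mono {R R' : Finset (Fin n)} (h : R ⊆ R') (i : Fin (n + 1)) : next R' i ≤ next R i :=
  Finset.min_mono (filter_subset_filter _ h)

/-- A point of `R` at or above `i` bounds `next R i`. [this work] -/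
theorem next_le_of_mem {R : Finset (Fin n)} {k : Fin n} (hk : k ∈ R) {i : Fin (n + 1)} (hik : (i : ℕ) ≤ (k : ℕ)) :
    next R i ≤ (k : WithTop (Fin n)) :=
  Finset.min_le (mem_filter.2 ⟨hk, hik⟩)

/-- Every candidate lies at or above `i`. [this work] -/
theorem le_next_of_forall {R : Finset (Fin n)} {i : Fin (n + 1)} {m : WithTop (Fin n)}
    (h : ∀ k ∈ R, (i : ℕ) ≤ (k : ℕ) → m ≤ (k : WithTop (Fin n))) : m ≤ next R i :=
  Finset.le_min fun k hk => by
    rw [mem_filter] at hk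
    exact h k hk.1 hk.2

/-- The next point of a member's own position is the member. [this work] -/
theorem next_eq_self_of_mem {R : Finset (Fin n)} {k : Fin n} (hk : k ∈ R) {i : Fin (n + 1)} (hik : (i : ℕ) = (k : ℕ)) :
    next R i = (k : WithTop (Fin n)) := by
  refine le_antisymm (next_le_of_mem hk hik.le) (le_next_of_forall fun k' _ hik' => ?_)
  rw [WithTop.coe_le_coe, Fin.le_iff_val_le_val]
  omega

/-- No candidate: `next R i = ⊤`. [this work] -/
theorem next_eq_top {R : Finset (Fin n)} {i : Fin (n + 1)} (h : ∀ k ∈ R, (k : ℕ) < (i : ℕ)) : next R i = ⊤ := by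
  unfold next
  rw [Finset.min_eq_top, filter_eq_empty_iff]
  intro k hk hik
  exact absurd (h k hk) (not_lt.2 hik)

/-- Inserting a point not above the position does not change the next point. [this work] -/
theorem next_insert_of_lt (R : Finset (Fin n)) {q : Fin n} {i : Fin (n + 1)} (h : (q : ℕ) < (i : ℕ)) :
    next (insert q R) i = next R i := by
  unfold next
  rw [filter_insert, if_neg (not_le.2 h)]

/-- Inserting a point above the position: the next point is the smaller of the two. [this work] -/
theorem next_insert_of_le (R : Finset (Fin n)) {q : Fin n} {i : Fin (n + 1)} (h : (i : ℕ) ≤ (q : ℕ)) :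
    next (insert q R) i = min (q : WithTop (Fin n)) (next R i) := by
  unfold next
  rw [filter_insert, if_pos h, Finset.min_insert]

/-- Membership in a prefix. [this work] -/
@[simp] theorem mem_pre {j : ℕ} {k : Fin n} : k ∈ (pre j : Finset (Fin n)) ↔ (k : ℕ) < j := by
  simp [pre]

/-- `pre 0 = ∅`. [this work] -/
theorem pre_zero : (pre 0 : Finset (Fin n)) = ∅ := by
  ext k; simp

/-- `pre n = univ`. [this work] -/
theorem pre_self : (pre n : Finset (Fin n)) = univ := by
  ext k; simp [k.2]

/-- `pre (q+1) = insert q (pre q)`. [this work] -/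
theorem pre_succ (q : Fin n) : (pre ((q : ℕ) + 1) : Finset (Fin n)) = insert q (pre q) := by
  ext k
  rw [mem_insert, mem_pre, mem_pre, Fin.ext_iff]
  omega

/-- `q ∉ pre q`. [this work] -/
theorem not_mem_pre_self (q : Fin n) : q ∉ (pre (q : ℕ) : Finset (Fin n)) := by
  simp

/-! ## Nonnegativity and monotonicity of `G` -/

/-- `G` is nonnegative for nonnegative data. [this work] -/
theorem G_nonneg (hx : ∀ i, 0 ≤ x i) (hF0 : ∀ k, 0 ≤ F k) (R : Finset (Fin n)) : 0 ≤ G x F R :=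
  sum_nonneg fun i _ => mul_nonneg (hx i) (hF0 _)

/-- `G` is antitone in the set. [this work] -/
theorem G_anti (hx : ∀ i, 0 ≤ x i) (hF : Monotone F) {R R' : Finset (Fin n)} (h : R ⊆ R') : G x F R' ≤ G x F R :=
  sum_le_sum fun i _ => mul_le_mul_of_nonneg_left (hF (next_mono h i)) (hx i)

/-! ## The removal lemma -/

section Removal

variable {S : Finset (Fin n)} {q : Fin n} (hlow : ∀ j : Fin n, (j : ℕ) < (q : ℕ) → j ∈ S)
include hlow

/-- Only the position `q` sees the insertion of `q`: `G S = G (insert q S) + x q · (F (next S q) − F q)`. [this work] -/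
theorem G_eq_G_insert_add :
    G x F S = G x F (insert q S) + x (Fin.castSucc q) * (F (next S (Fin.castSucc q)) - F (q : WithTop (Fin n))) := by
  unfold G
  have key : ∀ i : Fin (n + 1), x i * F (next S i) =
      x i * F (next (insert q S) i) + (if i = Fin.castSucc q then
        x (Fin.castSucc q) * (F (next S (Fin.castSucc q)) - F (q : WithTop (Fin n))) else 0) := by
    intro i
    by_cases hi : i = Fin.castSucc q
    · subst hi
      rw [if_pos rfl, next_insert_of_le S (by simp), min_eq_left (le_next_of_forall fun k _ hk => ?_)]
      · ring
      · rw [WithTop.coe_le_coe, Fin.le_iff_val_le_val]; simpa using hk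
    · rw [if_neg hi, add_zero]
      have hne : (i : ℕ) ≠ (q : ℕ) := fun h => hi (Fin.ext (by simpa using h))
      rcases lt_or_gt_of_ne hne with hlt | hgt
      · -- position below `q`: its own point is in `S`
        have hin : (⟨(i : ℕ), by omega⟩ : Fin n) ∈ S := hlow _ hlt
        rw [next_insert_of_le S hlt.le, next_eq_self_of_mem hin rfl, min_eq_right]
        rw [WithTop.coe_le_coe, Fin.le_iff_val_le_val]
        exact hlt.le
      · rw [next_insert_of_lt S hgt]
  rw [Finset.sum_congr rfl fun i _ => key i, sum_add_distrib, sum_ite_eq' univ (Fin.castSucc q), if_pos (mem_univ _)]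

omit hlow in
/-- The prefix instance of `G_eq_G_insert_add`: `G (pre q) = G (pre (q+1)) + x q · (F ⊤ − F q)`. [this work] -/
theorem G_pre_eq : G x F (pre (q : ℕ)) = G x F (pre ((q : ℕ) + 1)) +
    x (Fin.castSucc q) * (F ⊤ - F (q : WithTop (Fin n))) := by
  have h := G_eq_G_insert_add x F (S := pre (q : ℕ)) (q := q) (fun j hj => mem_pre.2 hj)
  rw [pre_succ, h, next_eq_top]
  intro k hk
  simpa using hk

/-- TERMWISE comparison behind the removal lemma: with `r = next S q` (the next point of `S` above `q`), for every position
`i`, `(F r − F q) · F (next (pre (q+1)) i) ≤ (F ⊤ − F q) · F (next (insert q S) i)`. [this work] -/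
theorem termwise (hF0 : ∀ k, 0 ≤ F k) (hF : Monotone F) (i : Fin (n + 1)) :
    (F (next S (Fin.castSucc q)) - F (q : WithTop (Fin n))) * F (next (pre ((q : ℕ) + 1)) i) ≤
      (F ⊤ - F (q : WithTop (Fin n))) * F (next (insert q S) i) := by
  rcases le_or_gt (i : ℕ) (q : ℕ) with hle | hgt
  · -- position at or below `q`: both next points are the position's own point
    have hlt : (i : ℕ) < n := lt_of_le_of_lt hle q.2
    set k : Fin n := ⟨(i : ℕ), hlt⟩ with hkdef
    have hk1 : k ∈ (pre ((q : ℕ) + 1) : Finset (Fin n)) := mem_pre.2 (by simp [hkdef]; omega)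
    have hk2 : k ∈ insert q S := by
      rcases hle.lt_or_eq with hlt' | heq
      · exact mem_insert_of_mem (hlow k hlt')
      · have : k = q := Fin.ext heq
        rw [this]; exact mem_insert_self q S
    rw [next_eq_self_of_mem hk1 rfl, next_eq_self_of_mem hk2 rfl]
    exact mul_le_mul_of_nonneg_right (sub_le_sub_right (hF le_top) _) (hF0 _)
  · -- position above `q`: the prefix has no point there, and `insert q S` has one at or above `r`
    rw [next_eq_top (fun k hk => lt_of_lt_of_le (mem_pre.1 hk) (by omega)), next_insert_of_lt S hgt]
    have hqr : F (q : WithTop (Fin n)) ≤ F (next S (Fin.castSucc q)) :=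
      hF (le_next_of_forall fun k _ hk => by
        rw [WithTop.coe_le_coe, Fin.le_iff_val_le_val]; simpa using hk)
    have hrk : F (next S (Fin.castSucc q)) ≤ F (next S i) :=
      hF (le_next_of_forall fun k hk hik => next_le_of_mem hk (by simp; omega))
    have hkt : F (next S i) ≤ F ⊤ := hF le_top
    have hq0 : 0 ≤ F (q : WithTop (Fin n)) := hF0 _
    nlinarith [mul_nonneg (sub_nonneg.2 (hqr.trans (hrk.trans hkt))) (sub_nonneg.2 hrk),
      mul_nonneg hq0 (sub_nonneg.2 (hrk.trans hkt))]

/-- **REMOVAL LEMMA.**  If `S` contains every point below `q`, then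
`G S · G (pre (q+1)) ≤ G (insert q S) · G (pre q)`. [this work] -/
theorem G_sdiff_ineq (hx : ∀ i, 0 ≤ x i) (hF0 : ∀ k, 0 ≤ F k) (hF : Monotone F) :
    G x F S * G x F (pre ((q : ℕ) + 1)) ≤ G x F (insert q S) * G x F (pre (q : ℕ)) := by
  have hsum : (F (next S (Fin.castSucc q)) - F (q : WithTop (Fin n))) * G x F (pre ((q : ℕ) + 1)) ≤
      (F ⊤ - F (q : WithTop (Fin n))) * G x F (insert q S) := by
    unfold G
    rw [mul_sum, mul_sum]
    refine sum_le_sum fun i _ => ?_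
    have h := mul_le_mul_of_nonneg_left (termwise F hlow hF0 hF i) (hx i)
    linarith [h]
  rw [G_eq_G_insert_add x F hlow, G_pre_eq x F (q := q)]
  nlinarith [hsum, hx (Fin.castSucc q), G_nonneg x F hx hF0 (insert q S)]

end Removal

/-! ## Theorem 1: the product inequality -/

/-- **THEOREM 1 (the chain game is balanced), product form.**  For every set of points `R`,
`G R · ∏_{k ∉ R} G (pre (k+1)) ≤ G univ · ∏_{k ∉ R} G (pre k)`. [this work] -/
theorem G_mul_prod_le (hx : ∀ i, 0 ≤ x i) (hF0 : ∀ k, 0 ≤ F k) (hF : Monotone F) (R : Finset (Fin n)) :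
    G x F R * ∏ k ∈ Rᶜ, G x F (pre ((k : ℕ) + 1)) ≤ G x F univ * ∏ k ∈ Rᶜ, G x F (pre (k : ℕ)) := by
  classical
  suffices h : ∀ (m : ℕ) (S : Finset (Fin n)), Sᶜ.card = m →
      G x F S * ∏ k ∈ Sᶜ, G x F (pre ((k : ℕ) + 1)) ≤ G x F univ * ∏ k ∈ Sᶜ, G x F (pre (k : ℕ)) from
    h _ R rfl
  intro m
  induction m with
  | zero =>
      intro S hS
      rw [Finset.card_eq_zero] at hS
      have hSu : S = univ := by simpa using hS
      rw [hS, hSu, prod_empty, prod_empty]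
  | succ m ih =>
      intro S hS
      have hne : Sᶜ.Nonempty := by rw [← card_pos, hS]; exact Nat.succ_pos m
      set q : Fin n := Sᶜ.min' hne with hqdef
      have hqc : q ∈ Sᶜ := min'_mem _ hne
      have hq : q ∉ S := mem_compl.1 hqc
      have hlow : ∀ j : Fin n, (j : ℕ) < (q : ℕ) → j ∈ S := by
        intro j hj
        by_contra hjS
        have := min'_le Sᶜ j (mem_compl.2 hjS)
        rw [← hqdef, Fin.le_iff_val_le_val] at this
        omega
      have hcompl : Sᶜ = insert q (insert q S)ᶜ := by
        ext k
        simp only [mem_compl, mem_insert, not_or]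
        constructor
        · intro hk
          by_cases hkq : k = q
          · exact Or.inl hkq
          · exact Or.inr ⟨hkq, hk⟩
        · rintro (rfl | ⟨_, hk⟩)
          · exact hq
          · exact hk
      have hq' : q ∉ (insert q S)ᶜ := by simp
      have hcard : (insert q S)ᶜ.card = m := by
        have := card_insert_of_notMem hq'
        rw [← hcompl, hS] at this
        omega
      have IH := ih (insert q S) hcard
      have REM := G_sdiff_ineq x F hlow hx hF0 hF
      have hP : 0 ≤ ∏ k ∈ (insert q S)ᶜ, G x F (pre ((k : ℕ) + 1)) :=
        prod_nonneg fun k _ => G_nonneg x F hx hF0 _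
      have hGq : 0 ≤ G x F (pre (q : ℕ)) := G_nonneg x F hx hF0 _
      rw [hcompl, prod_insert hq', prod_insert hq']
      calc G x F S * (G x F (pre ((q : ℕ) + 1)) * ∏ k ∈ (insert q S)ᶜ, G x F (pre ((k : ℕ) + 1)))
          = (G x F S * G x F (pre ((q : ℕ) + 1))) * ∏ k ∈ (insert q S)ᶜ, G x F (pre ((k : ℕ) + 1)) := by ring
        _ ≤ (G x F (insert q S) * G x F (pre (q : ℕ))) * ∏ k ∈ (insert q S)ᶜ, G x F (pre ((k : ℕ) + 1)) :=
          mul_le_mul_of_nonneg_right REM hP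
        _ = G x F (pre (q : ℕ)) * (G x F (insert q S) * ∏ k ∈ (insert q S)ᶜ, G x F (pre ((k : ℕ) + 1))) := by ring
        _ ≤ G x F (pre (q : ℕ)) * (G x F univ * ∏ k ∈ (insert q S)ᶜ, G x F (pre (k : ℕ))) :=
          mul_le_mul_of_nonneg_left IH hGq
        _ = G x F univ * (G x F (pre (q : ℕ)) * ∏ k ∈ (insert q S)ᶜ, G x F (pre (k : ℕ))) := by ring

/-- Telescoping: `(∏_k G (pre (k+1))) · G ∅ = (∏_k G (pre k)) · G univ`. [this work] -/
theorem prod_G_pre_succ_mul :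
    (∏ k : Fin n, G x F (pre ((k : ℕ) + 1))) * G x F ∅ = (∏ k : Fin n, G x F (pre (k : ℕ))) * G x F univ := by
  have h1 := Fin.prod_univ_eq_prod_range (fun j => G x F (pre (j + 1) : Finset (Fin n))) n
  have h2 := Fin.prod_univ_eq_prod_range (fun j => G x F (pre j : Finset (Fin n))) n
  rw [h1, h2, ← pre_zero (n := n), ← pre_self (n := n)]
  exact ((prod_range_succ' (fun j => G x F (pre j : Finset (Fin n))) n).symm.trans
    (prod_range_succ (fun j => G x F (pre j : Finset (Fin n))) n))

/-! ## The core point -/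

section Weights

variable {x F}

/-- Every value of `G` is positive once `G univ` is. [this work] -/
theorem G_pos (hx : ∀ i, 0 ≤ x i) (hF : Monotone F) (hpos : 0 < G x F univ) (R : Finset (Fin n)) : 0 < G x F R :=
  lt_of_lt_of_le hpos (G_anti x F hx hF (subset_univ R))

/-- The weights `τ k = G (pre (k+1)) / G (pre k)` lie in `(0, 1]`: positivity. [this work] -/
theorem weight_pos (hx : ∀ i, 0 ≤ x i) (hF : Monotone F) (hpos : 0 < G x F univ) (k : Fin n) :
    0 < G x F (pre ((k : ℕ) + 1)) / G x F (pre (k : ℕ)) :=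
  div_pos (G_pos hx hF hpos _) (G_pos hx hF hpos _)

/-- The weights `τ k = G (pre (k+1)) / G (pre k)` lie in `(0, 1]`: the upper bound. [this work] -/
theorem weight_le_one (hx : ∀ i, 0 ≤ x i) (hF : Monotone F) (hpos : 0 < G x F univ) (k : Fin n) :
    G x F (pre ((k : ℕ) + 1)) / G x F (pre (k : ℕ)) ≤ 1 := by
  rw [div_le_one (G_pos hx hF hpos _)]
  exact G_anti x F hx hF fun j hj => by
    rw [mem_pre] at hj ⊢
    omega

/-- The weights multiply to `G univ / G ∅`. [this work] -/
theorem prod_weights_eq (hx : ∀ i, 0 ≤ x i) (hF : Monotone F) (hpos : 0 < G x F univ) :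
    ∏ k : Fin n, G x F (pre ((k : ℕ) + 1)) / G x F (pre (k : ℕ)) = G x F univ / G x F ∅ := by
  rw [prod_div_distrib, div_eq_div_iff (ne_of_gt (prod_pos fun k _ => G_pos hx hF hpos _))
    (ne_of_gt (G_pos hx hF hpos _)), prod_G_pre_succ_mul x F, mul_comm]

/-- **THEOREM 1, core-point form.**  `G R ≤ G ∅ · ∏_{k ∈ R} τ k` with `τ k = G (pre (k+1)) / G (pre k)`: together with
`prod_weights_eq`, `weight_pos`, `weight_le_one` this says that `−log τ` (the marginal vector of the increasing order) is a
point of the core of the cost game `−log G` (for `G ∅ = 1`: `G R ≤ ∏_{k ∈ R} τ k` and `∏_k τ k = G univ`). [this work] -/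
theorem G_le_prod_weights (hx : ∀ i, 0 ≤ x i) (hF0 : ∀ k, 0 ≤ F k) (hF : Monotone F) (hpos : 0 < G x F univ)
    (R : Finset (Fin n)) :
    G x F R ≤ G x F ∅ * ∏ k ∈ R, G x F (pre ((k : ℕ) + 1)) / G x F (pre (k : ℕ)) := by
  classical
  have h := G_mul_prod_le x F hx hF0 hF R
  have hc : 0 < ∏ k ∈ Rᶜ, G x F (pre ((k : ℕ) + 1)) := prod_pos fun k _ => G_pos hx hF hpos _
  -- `G R ≤ G univ · ∏_{k ∉ R} (G (pre k) / G (pre (k+1)))`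
  have h1 : G x F R ≤ G x F univ * ∏ k ∈ Rᶜ, (G x F (pre (k : ℕ)) / G x F (pre ((k : ℕ) + 1))) := by
    rw [prod_div_distrib, mul_div_assoc', le_div_iff₀ hc]
    exact h
  refine h1.trans (le_of_eq ?_)
  -- rewrite `G univ = G ∅ · ∏_k τ k` and split the full product over `R` and `Rᶜ`
  have hsplit := prod_mul_prod_compl R fun k : Fin n => G x F (pre ((k : ℕ) + 1)) / G x F (pre (k : ℕ))
  have huniv : G x F univ = G x F ∅ * ∏ k : Fin n, G x F (pre ((k : ℕ) + 1)) / G x F (pre (k : ℕ)) := by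
    rw [prod_weights_eq hx hF hpos, mul_div_cancel₀ _ (ne_of_gt (G_pos hx hF hpos _))]
  have hcinv : (∏ k ∈ Rᶜ, G x F (pre (k : ℕ)) / G x F (pre ((k : ℕ) + 1))) *
      ∏ k ∈ Rᶜ, G x F (pre ((k : ℕ) + 1)) / G x F (pre (k : ℕ)) = 1 := by
    rw [← prod_mul_distrib]
    refine prod_eq_one fun k _ => ?_
    rw [div_mul_div_comm, mul_comm, div_self]
    exact ne_of_gt (mul_pos (G_pos hx hF hpos _) (G_pos hx hF hpos _))
  rw [huniv, ← hsplit]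
  calc G x F ∅ * ((∏ k ∈ R, G x F (pre ((k : ℕ) + 1)) / G x F (pre (k : ℕ))) *
        ∏ k ∈ Rᶜ, G x F (pre ((k : ℕ) + 1)) / G x F (pre (k : ℕ))) *
        ∏ k ∈ Rᶜ, G x F (pre (k : ℕ)) / G x F (pre ((k : ℕ) + 1))
      = G x F ∅ * (∏ k ∈ R, G x F (pre ((k : ℕ) + 1)) / G x F (pre (k : ℕ))) *
        ((∏ k ∈ Rᶜ, G x F (pre (k : ℕ)) / G x F (pre ((k : ℕ) + 1))) *
          ∏ k ∈ Rᶜ, G x F (pre ((k : ℕ) + 1)) / G x F (pre (k : ℕ))) := by ring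
    _ = G x F ∅ * ∏ k ∈ R, G x F (pre ((k : ℕ) + 1)) / G x F (pre (k : ℕ)) := by rw [hcinv, mul_one]

end Weights

end ChainGame

end Summit.CriticalPhenomena.PercolationContinuityZ3.Theorems.SunflowerPartition
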